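import Literature.Topology.FourManifolds.GroupTrisections
import Summits.SmoothPoincare4.SmoothPoincare4.Theorems.WaldhausenPairs.Negative.StandardPairSymmetries
import HarnessLib

/-!
# Stub `stub_goeritzSigma23` of line `power-twist-absorption` for crux `CongruenceShadows.ShadowsStandard`
(item stmt-SmoothPoincare4-14593, route route-SmoothPoincare4-CongruenceShadows; `--supports` the crux)

The Goeritz involution `σ₂₃` of the standard genus-3 Heegaard pair `(N₀, N₁)` of
`S₃ = ⟨a₁,b₁,a₂,b₂,a₃,b₃ ∣ [a₁,b₁][a₂,b₂][a₃,b₃]⟩`: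
`a₁ ↦ a₁⁻¹, b₁ ↦ a₁b₁a₁⁻¹, a₂ ↦ b₃, b₂ ↦ a₃, a₃ ↦ b₂, b₃ ↦ a₂`.
On the free group it sends the relator `r` to `u r⁻¹ u⁻¹` with `u = [b₁,a₁]` and squares to the
identity on generators (both identities are decided in the free group), so it descends to an
automorphism `χ = χ⁻¹` of `S₃`; it maps the generators `a₁, a₂, b₃` of `N₀ = ⟪a₁,a₂,b₃⟫` to
`a₁⁻¹, b₃, a₂ ∈ N₀` and the generators `a₁, b₂, a₃` of `N₁ = ⟪a₁,b₂,a₃⟫` to `a₁⁻¹, a₃, b₂ ∈ N₁`,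
whence `χ Nᵢ = Nᵢ` (an involution mapping the normal generators of `⟪s⟫` into `⟪s⟫` fixes `⟪s⟫`).
Def-free: the automorphism is built inside the proof from its generator images
(`exists_involution_of_gens`, pattern of `swapEquiv` in
`Theorems/WaldhausenPairs/Negative/StandardPairSymmetries.lean`); everything is proved from tree /
Mathlib declarations (no definitions, no named facts). Registered stub 3a of the checked skeleton of
the line (consumer: the genus-3 rung of `stub_powerTwistGate` there).
-/

set_option linter.dupNamespace false

noncomputable section

namespace Summit.SmoothPoincare4.SmoothPoincare4.Theorems.ShadowsStandard.PowerTwistAbsorption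

open Literature.Topology.FourManifolds Subgroup

/-- INVOLUTIONS OF `S_g` FROM GENERATOR IMAGES: a map `f` from generators to words which sends
the surface relator to a conjugate of its inverse (`lift f r = u r⁻¹ u⁻¹`, free-group level) and
is a free involution on generators (`lift f (f x) = x`) induces an automorphism `χ` of `S_g` with
`χ⁻¹ = χ` and `χ [w] = [lift f w]`. [folklore] -/
theorem exists_involution_of_gens {g : ℕ} (f : surfaceGen g → FreeGroup (surfaceGen g))
    (u : FreeGroup (surfaceGen g))
    (hr : FreeGroup.lift f (surfaceRelator g) = u * (surfaceRelator g)⁻¹ * u⁻¹)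
    (hinv : ∀ x, FreeGroup.lift f (f x) = FreeGroup.of x) :
    ∃ χ : SurfaceGroup g ≃* SurfaceGroup g, χ.symm = χ ∧
      ∀ w, χ (PresentedGroup.mk _ w) = PresentedGroup.mk _ (FreeGroup.lift f w) := by
  let φ : SurfaceGroup g →* SurfaceGroup g :=
    presentedLift ((PresentedGroup.mk _).comp (FreeGroup.lift f)) (by
      intro r hr'
      rw [Set.mem_singleton_iff] at hr'
      subst hr'
      rw [MonoidHom.comp_apply, hr, map_mul, map_mul, map_inv, map_inv,
        PresentedGroup.one_of_mem (Set.mem_singleton _), inv_one, mul_one, mul_inv_cancel])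
  have hφ : ∀ w, φ (PresentedGroup.mk _ w) = PresentedGroup.mk _ (FreeGroup.lift f w) :=
    fun w => presentedLift_mk _ _ w
  have hφφ : φ.comp φ = MonoidHom.id _ :=
    PresentedGroup.ext fun x => by
      simp only [MonoidHom.comp_apply, MonoidHom.id_apply, PresentedGroup.of, hφ,
        FreeGroup.lift_apply_of, hinv]
  exact ⟨MonoidHom.toMulEquiv φ φ hφφ hφφ, MulEquiv.ext fun _ => rfl, hφ⟩

/-- An involution `χ` of a group maps a normal closure `⟪s⟫` onto itself as soon as it maps `s`
into `⟪s⟫`. [folklore] -/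
theorem map_normalClosure_eq_of_symm_eq {G : Type*} [Group G] (χ : G ≃* G) (hχ : χ.symm = χ)
    (s : Set G) (h : ∀ x ∈ s, χ x ∈ normalClosure s) :
    (normalClosure s).map χ.toMonoidHom = normalClosure s := by
  -- adapted from `map_normalClosure_eq_of`
  -- (Literature/Topology/FourManifolds/StandardTrisectionSlotSymmetry.lean)
  apply le_antisymm
  · rw [Subgroup.map_le_iff_le_comap]
    exact normalClosure_le_normal fun x hx => by simpa using h x hx
  · rw [Subgroup.map_equiv_eq_comap_symm', hχ]
    exact normalClosure_le_normal fun x hx => by simpa using h x hx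

/-- **`stub_goeritzSigma23`** (Goeritz generator `σ₂₃`, genus 3): the involution
`σ₂₃ : a₁ ↦ a₁⁻¹, b₁ ↦ a₁b₁a₁⁻¹, a₂ ↦ b₃, b₂ ↦ a₃, a₃ ↦ b₂, b₃ ↦ a₂` is an automorphism of `S₃`
stabilising `N₀ = ⟪a₁,a₂,b₃⟫` and `N₁ = ⟪a₁,b₂,a₃⟫` (on the face `F₃ = S₃ ⧸ N₀ = F⟨b₁,b₂,a₃⟩` it
is the coordinate swap `(x,y,z) ↦ (x,z,y)`). [folklore] -/
theorem stub_goeritzSigma23 :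
    ∃ χ : SurfaceGroup 3 ≃* SurfaceGroup 3,
      χ (SurfaceGroup.a 0) = (SurfaceGroup.a 0)⁻¹ ∧
      χ (SurfaceGroup.b 0) = SurfaceGroup.a 0 * SurfaceGroup.b 0 * (SurfaceGroup.a 0)⁻¹ ∧
      χ (SurfaceGroup.a 1) = SurfaceGroup.b 2 ∧ χ (SurfaceGroup.b 1) = SurfaceGroup.a 2 ∧
      χ (SurfaceGroup.a 2) = SurfaceGroup.b 1 ∧ χ (SurfaceGroup.b 2) = SurfaceGroup.a 1 ∧
      (s4Kernels 0).map χ.toMonoidHom = s4Kernels 0 ∧ (s4Kernels 1).map χ.toMonoidHom = s4Kernels 1 := by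
  obtain ⟨χ, hsymm, hχ⟩ := exists_involution_of_gens (g := 3)
    (fun x => if x.1 = 0 then
        (if x.2 = false then (FreeGroup.of x)⁻¹ else genA 0 * FreeGroup.of x * (genA 0)⁻¹)
      else if x.1 = 1 then (if x.2 = false then genB 2 else genA 2)
      else (if x.2 = false then genB 1 else genA 1))
    (genB 0 * genA 0 * (genB 0)⁻¹ * (genA 0)⁻¹) (by decide) (by decide)
  have ha0 : χ (SurfaceGroup.a 0) = (SurfaceGroup.a 0)⁻¹ := by
    simp [SurfaceGroup.a, PresentedGroup.of, hχ]
  have hb0 : χ (SurfaceGroup.b 0) = SurfaceGroup.a 0 * SurfaceGroup.b 0 * (SurfaceGroup.a 0)⁻¹ := by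
    simp [SurfaceGroup.a, SurfaceGroup.b, PresentedGroup.of, hχ, genA, mul_assoc]
  have ha1 : χ (SurfaceGroup.a 1) = SurfaceGroup.b 2 := by
    simp [SurfaceGroup.a, SurfaceGroup.b, PresentedGroup.of, hχ, genB]
  have hb1 : χ (SurfaceGroup.b 1) = SurfaceGroup.a 2 := by
    simp [SurfaceGroup.a, SurfaceGroup.b, PresentedGroup.of, hχ, genA]
  have ha2 : χ (SurfaceGroup.a 2) = SurfaceGroup.b 1 := by
    simp [SurfaceGroup.a, SurfaceGroup.b, PresentedGroup.of, hχ, genB]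
  have hb2 : χ (SurfaceGroup.b 2) = SurfaceGroup.a 1 := by
    simp [SurfaceGroup.a, SurfaceGroup.b, PresentedGroup.of, hχ, genA]
  have h0 : s4Kernels 0 = normalClosure {SurfaceGroup.a 0, SurfaceGroup.a 1, SurfaceGroup.b 2} := rfl
  have h1 : s4Kernels 1 = normalClosure {SurfaceGroup.a 0, SurfaceGroup.b 1, SurfaceGroup.a 2} := rfl
  refine ⟨χ, ha0, hb0, ha1, hb1, ha2, hb2, ?_, ?_⟩
  · rw [h0]
    refine map_normalClosure_eq_of_symm_eq χ hsymm _ ?_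
    rintro x (rfl | rfl | rfl)
    · rw [ha0]
      exact inv_mem (subset_normalClosure (Set.mem_insert _ _))
    · rw [ha1]
      exact subset_normalClosure (Set.mem_insert_of_mem _ (Set.mem_insert_of_mem _ rfl))
    · rw [hb2]
      exact subset_normalClosure (Set.mem_insert_of_mem _ (Set.mem_insert _ _))
  · rw [h1]
    refine map_normalClosure_eq_of_symm_eq χ hsymm _ ?_
    rintro x (rfl | rfl | rfl)
    · rw [ha0]
      exact inv_mem (subset_normalClosure (Set.mem_insert _ _))
    · rw [hb1]
      exact subset_normalClosure (Set.mem_insert_of_mem _ (Set.mem_insert_of_mem _ rfl))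
    · rw [ha2]
      exact subset_normalClosure (Set.mem_insert_of_mem _ (Set.mem_insert _ _))

end Summit.SmoothPoincare4.SmoothPoincare4.Theorems.ShadowsStandard.PowerTwistAbsorption

end
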